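import Summits.QuantumFields.YangMills.Theorems.BalabanUVNodesK2CornerRoadRowsMassBand
import Summits.QuantumFields.YangMills.Theorems.BalabanUVNodesK1R9VersionSlotDefs

/-!
# Route `BalabanUVNodes` rev 29 — THE CORNER ROAD RE-KEYED AT THE VERSION SLOT (hypothesis form; 0 `def`, 0 `sorry`):
# the ∃-side corner producers of p621195 ∕ p622247 conclude the deciding crux K1⁹ `StabilityBRunRowsAtRecordR13SepCoPHV` (stmt-QuantumFields-27364) BY NAME,
# and the K-keyed supplier texts (U3ᴷ, U3ᴷ-lite, 2ᶜᴰ) take CRIT-2's ONE slot-keyed binder `(v : Node00.Revision₁₃ F 2 θ hP)` — (B) read AT THE SLOT datum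

Cell `ym-nodeO-ideate`, PROVER seat `ym-nodeO-port-1` (gen 4).  Seventh file of the corner road; sibling of `…K2CornerRoadRows` (p621195) and `…K2CornerRoadRowsMassBand` (p622247, this
seat); imports DEF-1 g9's by-name mirror of rev 28∕29 `…K1R9VersionSlotDefs` (p624736) for the door.  Helper keyed `--supports stmt-QuantumFields-27364 --as helper` (K1⁹, crux r3 DECIDING since rev 28 `d29449c29421` ∕ rev 29 `5c92291ad69b`; dag-lead KEY MAP v2, director-ym №31 (2));
count-neutral; NO skeleton is registered or re-keyed by this file (K1 «v8ʳᵉᶠˡ» af6142d41a059787 keeps v7ᴿ's three stub texts byte-identical).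

WHY.  Rev 28 re-typed the deciding K1 display through DEF-1's VERSION SLOT (`Literature/…/Node00/Record13SepCoPHV.lean`): the witness tuple of K1⁹ carries `v : Node00.Revision₁₃ F 2 θ h`
(a re-choice of the record tower's densities above level 0 on `dV`-null sets) and the (B) conjunct `B16.EndStatementBPrinted D.C` and the non-vacuity window are read at the SLOT datum
`D := Node00.datumOfRecord₁₃SepCoPHV F 2 θ h v`; the rows (i)(iv)(C) of `β_θ := Node00.betaOfRecord₁₃ F 2 θ.toStage13Params` are θ-level, slot-free, UNCHANGED.  Two consequences for the
corner road (HOME HANDOFF «PORT-1 seat — g3 ADDENDUM 2» T1‴; CRIT-2 g3 HOME STATUS S.2058 (ii)(a)(b) = E-CRIT2-3; CRIT-1 g6 S.2059; director-ym №31 (2)):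
(a) every ∃-side producer of K1⁸ (p621195 §3–§4, p622247 §3) mentions NO (B) among its hypotheses — (B) and the window are manufactured AT THE RECORD from the rung-1 world — so it concludes
K1⁹ VERBATIM through DEF-1's door `stabilityBRunRowsAtRecordR13SepCoPHV_of_k1R8` (`v := Node00.Revision₁₃.refl`; `Node00.datumOfRecord₁₃SepCoPHV_refl` is `rfl`); §1 below.  (b) the K-KEYED supplier texts of p613914 ∕ p620216 ∕ p622247
(`∀ F θ hP, unity∧slots → Adm → (B)(datumOfRecord₁₃SepCoPH F 2 θ hP) → Window13 F θ hP → letters`) quote (B) AT THE RECORD as an ANTECEDENT; a genuinely slot-keyed K1 witness supplies only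
`(B)ⱽ := B16.EndStatementBPrinted (Node00.datumOfRecord₁₃SepCoPHV F 2 θ hP v).C`, so the K1⁹-currency editions of those texts take ONE more binder `(v : Node00.Revision₁₃ F 2 θ hP)` and read
the datum at the slot THROUGHOUT (antecedent (B)ⱽ; window `K1V6Defs.Window (datumOfRecord₁₃SepCoPHV …)`; the letters' `D.βfun` — the β face, the flow face and [V] Thm 1's clause are
version-free by `rfl`, `Node00.βfun_datumOfRecord₁₃SepCoPHV` ∕ `flow_…` ∕ `thm1Printed_…_iff`, so ONLY the Cor-3 half of the antecedent actually moves); conclusions unchanged; §2–§3 below.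

CONTENTS.  §1 K1⁹ BY NAME from the four ∃-side corner producers (hypotheses VERBATIM p621195 ∕ p622247): ★★ `stabilityBRunRowsAtRecordR13SepCoPHV_of_ceilingKeyedRung1WithMassBandCornerLetters`
(N17-free, match-free; R-BM) · `…V_of_rung1WithMassBandCornerLetters` · `…V_of_ceilingKeyedRung1WithCornerLetters` · `…V_of_rung1WithCornerLetters` (N17-keyed: harmless theorems, presumptively
dead supplier roads at the current record per CRIT-2 E-CRIT2-2 — kept for the record).  §2 THE SLOT-KEYED TEXTS: `u3LiteKV_of_u3KV` · ★★ `rowsContAllV_of_u3LiteKV_cornerDriftPosKV`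
(U3ᴷ-liteⱽ + 2ᶜᴰⱽ ⟹ the slot-keyed ∀θ rows programme «∀ F θ hP v, unity∧slots → Adm → (B)ⱽ → Windowⱽ → `RunRowsCont13 F θ`», inline) · ★ `stabilityBRunRowsAtRecordR13SepCoPHV_of_k17V_rowsContAllV`
(the slot-keyed K1⁷-shape «∃ θ h v, unity∧slots ∧ Adm ∧ (B)ⱽ ∧ Windowⱽ» + the programme ⟹ K1⁹ BY NAME) · ★ `…V_of_k17V_u3LiteKV_cornerDriftPosKV` · `…V_of_k17V_u3KV_cornerDriftPosKV`.  §3 TRANSFER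
(generic in the letter `Q F θ hP`): `slotText_of_bFreeText` (a supplier text that does not read (B) serves EVERY slot) · `slotText_of_thm1Text` (so does one reading [V] Thm 1's clause only — the
version-free half of (B), `B16.EndStatementBPrinted = Thm1Printed ∧ Cor3_250`) · `recordText_of_slotText` (`v := refl`: the slot edition is the STRONGER text); then `rowsContAll_of_u3LiteKV_cornerDriftPosKV`
(the slot texts still pay DEF-1's RECORD programme `RowsContAll`, hence every rev-27 concluder) · `stabilityBRunRowsAtRecordR13SepCoPHV_of_k17_u3LiteKV_cornerDriftPosKV` (aside K1⁷ + slot texts ⟹ K1⁹) ·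
★ `stabilityBRunRowsAtRecordR13SepCoPHV_of_k17V_bFree_u3Lite_cornerDriftPos` (K1⁷ⱽ-shape + the two corner letters keyed on admissibility and the record window ALONE ⟹ K1⁹ — the suppliers' honest
currency) · `…V_of_k17V_thm1_u3Lite_cornerDriftPos` (letters keyed on [V] Thm 1's clause) · `…V_of_k17ExistsSlot_bFree_u3Lite_cornerDriftPos` (witness displayed with «∃ v, (B)ⱽ» inside, dag-n13-w1's
junction shape).  The door K1⁸ ⟹ K1⁹ is DEF-1 g9's `…K1R9VersionSlotDefs.stabilityBRunRowsAtRecordR13SepCoPHV_of_k1R8` (p624736) BY NAME; nothing of DEF-1 ∕ dag-n24-w1 ∕ dag-n18-w1 ∕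
dag-n13-w1 ∕ an4 is restated.

HONEST FRAMING.  Implications between displayed HYPOTHESIS SHAPES and a `rfl` door; NOTHING of Bałaban's analysis is asserted or discharged; whether U3ᴷ-lite ∕ the anchor ∕ the drift ∕ (B)ⱽ
are inhabited at the record is the U3 ∕ N18 ∕ F-E ∕ (D1) ∕ N13 desks' question, NOT claimed (instance 0∕1); no stub proved; K0⁷ ∕ K1⁹ ∕ K3⁸ OPEN; counts unmoved (typed 28∕28 · discharged
5∕27 (A 5∕28)); [Balaban1987RG1] Thm 2 + (0.31) p. 259 and §1's continuity are UNPROVED IN PRINT; [Balaban1988Convergent] Cor. 3 (2.50) is proved in no currency here; route R4 closes the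
CONDITIONAL finite-𝕋⁴ rung `BalabanLadder.UV` only — NOT the continuum limit, NOT ℝ⁴, NOT OS, NOT the Yang–Mills mass gap, NOT Clay.  No `def`, no `instance`, no `notation`, no `axiom`.
Sources (context only): [I] = [Balaban1987RG1] CMP **109** (1987): Thm 2 p. 259, §1 pp. 263–264, Thm 3 p. 264, (2.12)–(2.14) p. 268, (5.10) p. 293; [III] = [Balaban1988Convergent] CMP **119**
(1988): Thm 1 p. 262, (2.18) p. 257, Cor. 3 (2.50) p. 264; [V] = [Balaban1989LargeFieldII] CMP **122** (1989): Thm 1 p. 355.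
-/

noncomputable section

open scoped Matrix.Norms.L2Operator

namespace Summit.QuantumFields.YangMills.Theorems.BalabanUVNodesK2CornerRoadRowsV

open Literature.MathematicalPhysics.QuantumFieldTheory.Balaban1983to89
open Literature.MathematicalPhysics.QuantumFieldTheory.Balaban1983to89.FlowStep
open Literature.MathematicalPhysics.QuantumFieldTheory.Balaban1983to89.FlowStepRuns
open Literature.MathematicalPhysics.QuantumFieldTheory.Balaban1983to89.DagBinding
open Literature.MathematicalPhysics.QuantumFieldTheory.Balaban1983to89.T4Continuum (T4Family)
open Literature.MathematicalPhysics.QuantumFieldTheory.Balaban1983to89.T4CouplingMatching (ScaleShiftRate HistLipschitz FadingMemory)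
open Literature.MathematicalPhysics.QuantumFieldTheory.Balaban1983to89.Beta.Drift (OneLoopDrift)
open Summit.QuantumFields.YangMills.Theorems.BalabanUVNodesK2NamedJetsRemAt (ScaleAnchor)
open Summit.QuantumFields.YangMills.Theorems.BalabanUVNodesK2V6Defs (Window13)
open Summit.QuantumFields.YangMills.Theorems.K1V6Defs (RecordS Inhabited13 Window)
open Summit.QuantumFields.YangMills.Theorems.BalabanUVNodesK1R8RowsDefs (RunRowsCont13 RowsContAll)
open Summit.QuantumFields.YangMills.Theorems.BalabanUVNodesK1R8RowsDefs (stabilityBRunRowsAtRecordR13SepCoPH_of_k17_rowsContAll)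
open Summit.QuantumFields.YangMills.Theses.BalabanUVNodes (StabilityBAtRecordR13SepCoPH StabilityBRunRowsAtRecordR13SepCoPHV)
open Summit.QuantumFields.YangMills.Theorems.BalabanUVNodesK1R9VersionSlotDefs (stabilityBRunRowsAtRecordR13SepCoPHV_of_k1R8)
open Summit.QuantumFields.YangMills.Theorems.BalabanUVNodesK2CornerRoadRows
  (stabilityBRunRowsAtRecordR13SepCoPH_of_rung1WithCornerLetters stabilityBRunRowsAtRecordR13SepCoPH_of_ceilingKeyedRung1WithCornerLetters)
open Summit.QuantumFields.YangMills.Theorems.BalabanUVNodesK2CornerRoadRowsMassBand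
  (runRowsCont13_of_moduliMass_scaleAnchor_drift rowsContAll_of_u3LiteK_cornerDriftPosK stabilityBRunRowsAtRecordR13SepCoPH_of_ceilingKeyedRung1WithMassBandCornerLetters
    stabilityBRunRowsAtRecordR13SepCoPH_of_rung1WithMassBandCornerLetters)
open YMDAG.N18.CornerBandOfKernelLetters (sum_abs_moduli_le_of_fadingMemory)

/-! ## §1 K1⁹ BY NAME from the four ∃-side corner producers (hypotheses VERBATIM; they mention no (B)) -/

section Witness

/-- **★★ K1⁹ stmt-QuantumFields-27364 BY NAME ON THE MASS-BAND ROAD — N17-FREE, MATCH-FREE** (R-BM's producer p622247 ★★ through DEF-1's `refl` door `…V_of_k1R8`): for every family with a unity Stage-13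
tuple, SOME unity admissible tuple `θ` with provisos carries a CEILING-KEYED family of S-bound worlds of its datum with the thirteen nodes, history moduli of its datum's β with BOUNDED MASS
(U3ᴷ-lite), and a per-scale anchor drifting with a POSITIVE slope ⟹ `…Theses.BalabanUVNodes.StabilityBRunRowsAtRecordR13SepCoPHV` (the TYPE is the route decl literally; the version slot
is filled by `Revision₁₃.refl`, (B) at the record being manufactured from the rung-1 world by the END road of record).  CONDITIONAL on `hprod` (not supplied here); K1⁹ NOT closed by this
theorem; nothing of Bałaban asserted; no count moved.
[cite: Balaban1989LargeFieldII, Thm 1 p.355 and (0.1) pp.355-356; Balaban1988Convergent, Thm 1 p.262, (2.18) p.257; Balaban1987RG1, Thm 2 p.259 (first sentence), Thm 3 p.264, (2.12)-(2.14) p.268, (5.10) p.293, §1 pp.263-264] -/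
theorem stabilityBRunRowsAtRecordR13SepCoPHV_of_ceilingKeyedRung1WithMassBandCornerLetters
    (hprod : ∀ F : T4Family, Inhabited13 F →
      ∃ (θ : Node00.Stage13HParams F 2) (h : θ.Provisos₁₃SepCoPH F 2), (θ.ZhUnity F 2 ∧ θ.SlotsNondegenerate₁₃ F 2) ∧ θ.Admissible F 2 ∧
        (∀ c : ℝ, ∃ w : WorldP, c ≤ w.βup ∧ RecordS F θ h w ∧ ∀ P : B12.RunParams, Nodes (leavesP w P)) ∧
        (∃ (Λ : ℕ → ℕ → ℝ) (M : ℝ), HistLipschitz Λ θ.γ (Node00.datumOfRecord₁₃SepCoPH F 2 θ h).βfun ∧ ∀ k, ∑ i : Fin (k + 1), |Λ k i| ≤ M) ∧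
        ∃ (b : ℕ → ℝ) (s A : ℝ), ScaleAnchor (Node00.datumOfRecord₁₃SepCoPH F 2 θ h).βfun b ∧ 0 < s ∧ OneLoopDrift s A b) :
    StabilityBRunRowsAtRecordR13SepCoPHV :=
  stabilityBRunRowsAtRecordR13SepCoPHV_of_k1R8 (stabilityBRunRowsAtRecordR13SepCoPH_of_ceilingKeyedRung1WithMassBandCornerLetters hprod)

/-- **… WITH A PINNED WORLD (mass band, any slack `s + 2A < w.βup`)** — p622247's producer through the `refl` door.  CONDITIONAL; K1⁹ NOT closed.
[cite: Balaban1989LargeFieldII, Thm 1 p.355 and (0.1) pp.355-356; Balaban1987RG1, Thm 2 p.259 (first sentence), Thm 3 p.264, (2.12)-(2.14) p.268, (5.10) p.293, §1 pp.263-264] -/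
theorem stabilityBRunRowsAtRecordR13SepCoPHV_of_rung1WithMassBandCornerLetters
    (hprod : ∀ F : T4Family, Inhabited13 F →
      ∃ (θ : Node00.Stage13HParams F 2) (h : θ.Provisos₁₃SepCoPH F 2), (θ.ZhUnity F 2 ∧ θ.SlotsNondegenerate₁₃ F 2) ∧ θ.Admissible F 2 ∧
        (∃ (Λ : ℕ → ℕ → ℝ) (M : ℝ), HistLipschitz Λ θ.γ (Node00.datumOfRecord₁₃SepCoPH F 2 θ h).βfun ∧ ∀ k, ∑ i : Fin (k + 1), |Λ k i| ≤ M) ∧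
        ∃ (b : ℕ → ℝ) (s A : ℝ), ScaleAnchor (Node00.datumOfRecord₁₃SepCoPH F 2 θ h).βfun b ∧ 0 < s ∧ OneLoopDrift s A b ∧
          ∃ w : WorldP, s + 2 * A < w.βup ∧ RecordS F θ h w ∧ ∀ P : B12.RunParams, Nodes (leavesP w P)) :
    StabilityBRunRowsAtRecordR13SepCoPHV :=
  stabilityBRunRowsAtRecordR13SepCoPHV_of_k1R8 (stabilityBRunRowsAtRecordR13SepCoPH_of_rung1WithMassBandCornerLetters hprod)

/-- **K1⁹ BY NAME FROM THE N17-KEYED CEILING-KEYED PRODUCER** (p621195 §4 ★★ through the `refl` door; K3⁷'s U3 letters `ScaleShiftRate` + moduli): a harmless theorem — per CRIT-2 E-CRIT2-2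
the N17 rate is presumptively uninhabited at the current record, the mass-band road above is the live re-type.  CONDITIONAL; K1⁹ NOT closed.
[cite: Balaban1989LargeFieldII, Thm 1 p.355 and (0.1) pp.355-356; Balaban1988Convergent, Thm 1 p.262; Balaban1987RG1, Thm 2 p.259 (first sentence), Thm 3 p.264, (1.20)-(1.22) p.264, (2.12)-(2.14) p.268, (5.10) p.293, §1 pp.263-264] -/
theorem stabilityBRunRowsAtRecordR13SepCoPHV_of_ceilingKeyedRung1WithCornerLetters
    (hprod : ∀ F : T4Family, Inhabited13 F →
      ∃ (θ : Node00.Stage13HParams F 2) (h : θ.Provisos₁₃SepCoPH F 2), (θ.ZhUnity F 2 ∧ θ.SlotsNondegenerate₁₃ F 2) ∧ θ.Admissible F 2 ∧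
        (∀ c : ℝ, ∃ w : WorldP, c ≤ w.βup ∧ RecordS F θ h w ∧ ∀ P : B12.RunParams, Nodes (leavesP w P)) ∧
        (∃ (c ρ : ℝ) (Λ : ℕ → ℕ → ℝ), 0 ≤ ρ ∧ ρ < 1 ∧ ScaleShiftRate c ρ θ.γ (Node00.datumOfRecord₁₃SepCoPH F 2 θ h).βfun ∧
          HistLipschitz Λ θ.γ (Node00.datumOfRecord₁₃SepCoPH F 2 θ h).βfun) ∧
        ∃ (b : ℕ → ℝ) (s A : ℝ), ScaleAnchor (Node00.datumOfRecord₁₃SepCoPH F 2 θ h).βfun b ∧ 0 < s ∧ OneLoopDrift s A b) :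
    StabilityBRunRowsAtRecordR13SepCoPHV :=
  stabilityBRunRowsAtRecordR13SepCoPHV_of_k1R8 (stabilityBRunRowsAtRecordR13SepCoPH_of_ceilingKeyedRung1WithCornerLetters hprod)

/-- **… AND FROM THE N17-KEYED PINNED-WORLD PRODUCER** (p621195 §3 ★ through the `refl` door; any slack `s + 2A < w.βup`).  Harmless theorem (CRIT-2 E-CRIT2-2); CONDITIONAL; K1⁹ NOT closed.
[cite: Balaban1989LargeFieldII, Thm 1 p.355 and (0.1) pp.355-356; Balaban1987RG1, Thm 2 p.259 (first sentence), Thm 3 p.264, (1.20)-(1.22) p.264, (2.12)-(2.14) p.268, (5.10) p.293, §1 pp.263-264] -/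
theorem stabilityBRunRowsAtRecordR13SepCoPHV_of_rung1WithCornerLetters
    (hprod : ∀ F : T4Family, Inhabited13 F →
      ∃ (θ : Node00.Stage13HParams F 2) (h : θ.Provisos₁₃SepCoPH F 2), (θ.ZhUnity F 2 ∧ θ.SlotsNondegenerate₁₃ F 2) ∧ θ.Admissible F 2 ∧
        (∃ (c ρ : ℝ) (Λ : ℕ → ℕ → ℝ), 0 ≤ ρ ∧ ρ < 1 ∧ ScaleShiftRate c ρ θ.γ (Node00.datumOfRecord₁₃SepCoPH F 2 θ h).βfun ∧
          HistLipschitz Λ θ.γ (Node00.datumOfRecord₁₃SepCoPH F 2 θ h).βfun) ∧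
        ∃ (b : ℕ → ℝ) (s A : ℝ), ScaleAnchor (Node00.datumOfRecord₁₃SepCoPH F 2 θ h).βfun b ∧ 0 < s ∧ OneLoopDrift s A b ∧
          ∃ w : WorldP, s + 2 * A < w.βup ∧ RecordS F θ h w ∧ ∀ P : B12.RunParams, Nodes (leavesP w P)) :
    StabilityBRunRowsAtRecordR13SepCoPHV :=
  stabilityBRunRowsAtRecordR13SepCoPHV_of_k1R8 (stabilityBRunRowsAtRecordR13SepCoPH_of_rung1WithCornerLetters hprod)

end Witness

/-! ## §2 The slot-keyed K-texts (CRIT-2 E-CRIT2-3 (ii)(b): ONE binder `v` added, the datum read at the slot throughout) -/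

section SlotTexts

/-- **U3ᴷⱽ ⟹ U3ᴷ-liteⱽ** (the slot edition of p622247's `u3LiteK_of_u3K`): at every slot, K3⁷'s shared triple (N17 rate, moduli, `FadingMemory C ρ Λ` with `0 < ρ < 1`) gives the lite
letter with mass `C(1−ρ)⁻¹` (dag-n18-w1's `sum_abs_moduli_le_of_fadingMemory`).  Bookkeeping; nothing of Bałaban asserted. [cite: Balaban1987RG1, (2.12)-(2.14) p.268 and §5 p.298] -/
theorem u3LiteKV_of_u3KV
    (hU3 : ∀ (F : T4Family) (θ : Node00.Stage13HParams F 2) (hP : θ.Provisos₁₃SepCoPH F 2) (v : Node00.Revision₁₃ F 2 θ hP),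
      (θ.ZhUnity F 2 ∧ θ.SlotsNondegenerate₁₃ F 2) → θ.Admissible F 2 →
      B16.EndStatementBPrinted (Node00.datumOfRecord₁₃SepCoPHV F 2 θ hP v).C → Window (Node00.datumOfRecord₁₃SepCoPHV F 2 θ hP v) →
      ∃ (c C ρ : ℝ) (Λ : ℕ → ℕ → ℝ), 0 ≤ c ∧ 0 < ρ ∧ ρ < 1 ∧ ScaleShiftRate c ρ θ.γ (Node00.datumOfRecord₁₃SepCoPHV F 2 θ hP v).βfun ∧
        HistLipschitz Λ θ.γ (Node00.datumOfRecord₁₃SepCoPHV F 2 θ hP v).βfun ∧ FadingMemory C ρ Λ) :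
    ∀ (F : T4Family) (θ : Node00.Stage13HParams F 2) (hP : θ.Provisos₁₃SepCoPH F 2) (v : Node00.Revision₁₃ F 2 θ hP),
      (θ.ZhUnity F 2 ∧ θ.SlotsNondegenerate₁₃ F 2) → θ.Admissible F 2 →
      B16.EndStatementBPrinted (Node00.datumOfRecord₁₃SepCoPHV F 2 θ hP v).C → Window (Node00.datumOfRecord₁₃SepCoPHV F 2 θ hP v) →
      ∃ (Λ : ℕ → ℕ → ℝ) (M : ℝ), HistLipschitz Λ θ.γ (Node00.datumOfRecord₁₃SepCoPHV F 2 θ hP v).βfun ∧ ∀ k, ∑ i : Fin (k + 1), |Λ k i| ≤ M :=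
  fun F θ hP v hU hθ hB hwin => by
  obtain ⟨-, C, ρ, Λ, -, hρ0, hρ1, -, hL, hF⟩ := hU3 F θ hP v hU hθ hB hwin
  exact ⟨Λ, C * (1 - ρ)⁻¹, hL, fun k => sum_abs_moduli_le_of_fadingMemory hF hρ0.le hρ1 k⟩

/-- **★★ U3ᴷ-liteⱽ + 2ᶜᴰⱽ PAY THE SLOT-KEYED ∀θ ROWS PROGRAMME** «∀ F θ hP v, unity∧slots → Adm → (B)ⱽ → Windowⱽ → `RunRowsCont13 F θ`» (the K1⁹-currency edition of DEF-1's `RowsContAll`,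
spelled inline — no `def`): per tuple and slot, p622247's ★ `runRowsCont13_of_moduliMass_scaleAnchor_drift` — the letters' `D.βfun` at the slot datum IS `Node00.betaOfRecord₁₃ F 2 θ.toStage13Params`
(`Node00.βfun_datumOfRecord₁₃SepCoPHV`, `rfl`), the rows are θ-level.  N17-free, `FadingMemory`-free.  CONDITIONAL on two hypothesis shapes; instance 0∕1; nothing of Bałaban asserted.
[cite: Balaban1987RG1, Thm 3 p.264, (2.12)-(2.14) p.268, (5.10) p.293, §1 pp.263-264 and §5 p.298; Balaban1988Convergent, (2.18) p.257, Cor. 3 (2.50) p.264 (bookkeeping)] -/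
theorem rowsContAllV_of_u3LiteKV_cornerDriftPosKV
    (hLite : ∀ (F : T4Family) (θ : Node00.Stage13HParams F 2) (hP : θ.Provisos₁₃SepCoPH F 2) (v : Node00.Revision₁₃ F 2 θ hP),
      (θ.ZhUnity F 2 ∧ θ.SlotsNondegenerate₁₃ F 2) → θ.Admissible F 2 →
      B16.EndStatementBPrinted (Node00.datumOfRecord₁₃SepCoPHV F 2 θ hP v).C → Window (Node00.datumOfRecord₁₃SepCoPHV F 2 θ hP v) →
      ∃ (Λ : ℕ → ℕ → ℝ) (M : ℝ), HistLipschitz Λ θ.γ (Node00.datumOfRecord₁₃SepCoPHV F 2 θ hP v).βfun ∧ ∀ k, ∑ i : Fin (k + 1), |Λ k i| ≤ M)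
    (hCD : ∀ (F : T4Family) (θ : Node00.Stage13HParams F 2) (hP : θ.Provisos₁₃SepCoPH F 2) (v : Node00.Revision₁₃ F 2 θ hP),
      (θ.ZhUnity F 2 ∧ θ.SlotsNondegenerate₁₃ F 2) → θ.Admissible F 2 →
      B16.EndStatementBPrinted (Node00.datumOfRecord₁₃SepCoPHV F 2 θ hP v).C → Window (Node00.datumOfRecord₁₃SepCoPHV F 2 θ hP v) →
      ∃ (b : ℕ → ℝ) (s A : ℝ), ScaleAnchor (Node00.datumOfRecord₁₃SepCoPHV F 2 θ hP v).βfun b ∧ 0 < s ∧ OneLoopDrift s A b) :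
    ∀ (F : T4Family) (θ : Node00.Stage13HParams F 2) (hP : θ.Provisos₁₃SepCoPH F 2) (v : Node00.Revision₁₃ F 2 θ hP),
      (θ.ZhUnity F 2 ∧ θ.SlotsNondegenerate₁₃ F 2) → θ.Admissible F 2 →
      B16.EndStatementBPrinted (Node00.datumOfRecord₁₃SepCoPHV F 2 θ hP v).C → Window (Node00.datumOfRecord₁₃SepCoPHV F 2 θ hP v) → RunRowsCont13 F θ := by
  intro F θ hP v hU hθ hB hwin
  obtain ⟨Λ, M, hL, hM⟩ := hLite F θ hP v hU hθ hB hwin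
  obtain ⟨b, s, A, hb, hs, hdrift⟩ := hCD F θ hP v hU hθ hB hwin
  exact runRowsCont13_of_moduliMass_scaleAnchor_drift F θ hP hθ.toStage12.toStage9.gamma_pos hL hM hb hs hdrift

/-- **★ THE SLOT-KEYED K1⁷-SHAPE + THE SLOT-KEYED ROWS PROGRAMME ⟹ THE DECIDING CRUX K1⁹ `…Theses.BalabanUVNodes.StabilityBRunRowsAtRecordR13SepCoPHV` (stmt-QuantumFields-27364) BY NAME**
(the K1⁹-currency edition of DEF-1's `stabilityBRunRowsAtRecordR13SepCoPH_of_k17_rowsContAll`): the K1⁷-shape «∀ F, Inhabited13 F → ∃ θ h v, unity∧slots ∧ Adm ∧ (B)ⱽ ∧ Windowⱽ» (K1⁹ minus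
its rows — what a (B)-supplier through the slot delivers, spelled inline) and the programme read AT THAT WITNESS AND SLOT give K1⁹ (the TYPE is the route decl literally; K1⁹'s antecedent IS
`Inhabited13 F` and its window ∕ rows conjuncts ARE `Window (datumⱽ)` ∕ `RunRowsCont13 F θ`, definitionally).  CONDITIONAL on both displayed texts (none supplied here); K1⁹ NOT closed; nothing of
Bałaban asserted; no count moved. [cite: Balaban1989LargeFieldII, Thm 1 p.355; Balaban1988Convergent, Cor. 3 (2.50) p.264; Balaban1987RG1, Thm 3 p.264, (5.10) p.293, §1 pp.263-264 (bookkeeping)] -/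
theorem stabilityBRunRowsAtRecordR13SepCoPHV_of_k17V_rowsContAllV
    (h1V : ∀ F : T4Family, Inhabited13 F →
      ∃ (θ : Node00.Stage13HParams F 2) (h : θ.Provisos₁₃SepCoPH F 2) (v : Node00.Revision₁₃ F 2 θ h), (θ.ZhUnity F 2 ∧ θ.SlotsNondegenerate₁₃ F 2) ∧ θ.Admissible F 2 ∧
        B16.EndStatementBPrinted (Node00.datumOfRecord₁₃SepCoPHV F 2 θ h v).C ∧ Window (Node00.datumOfRecord₁₃SepCoPHV F 2 θ h v))
    (hV : ∀ (F : T4Family) (θ : Node00.Stage13HParams F 2) (hP : θ.Provisos₁₃SepCoPH F 2) (v : Node00.Revision₁₃ F 2 θ hP),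
      (θ.ZhUnity F 2 ∧ θ.SlotsNondegenerate₁₃ F 2) → θ.Admissible F 2 →
      B16.EndStatementBPrinted (Node00.datumOfRecord₁₃SepCoPHV F 2 θ hP v).C → Window (Node00.datumOfRecord₁₃SepCoPHV F 2 θ hP v) → RunRowsCont13 F θ) :
    StabilityBRunRowsAtRecordR13SepCoPHV := by
  intro F hF
  obtain ⟨θ, h, v, hU, hθ, hB, hwin⟩ := h1V F hF
  exact ⟨θ, h, v, hU, hθ, hB, hwin, hV F θ h v hU hθ hB hwin⟩

/-- **★ THE SLOT-KEYED K1⁷-SHAPE + U3ᴷ-liteⱽ + 2ᶜᴰⱽ ⟹ K1⁹ BY NAME** (composition of the two theorems above: the genuinely slot-keyed corner road to the deciding crux).  CONDITIONAL on three displayed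
texts (none supplied here); K1⁹ NOT closed; nothing of Bałaban asserted; no count moved.
[cite: Balaban1989LargeFieldII, Thm 1 p.355; Balaban1988Convergent, Cor. 3 (2.50) p.264; Balaban1987RG1, Thm 3 p.264, (2.12)-(2.14) p.268, (5.10) p.293, §1 pp.263-264 and §5 p.298] -/
theorem stabilityBRunRowsAtRecordR13SepCoPHV_of_k17V_u3LiteKV_cornerDriftPosKV
    (h1V : ∀ F : T4Family, Inhabited13 F →
      ∃ (θ : Node00.Stage13HParams F 2) (h : θ.Provisos₁₃SepCoPH F 2) (v : Node00.Revision₁₃ F 2 θ h), (θ.ZhUnity F 2 ∧ θ.SlotsNondegenerate₁₃ F 2) ∧ θ.Admissible F 2 ∧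
        B16.EndStatementBPrinted (Node00.datumOfRecord₁₃SepCoPHV F 2 θ h v).C ∧ Window (Node00.datumOfRecord₁₃SepCoPHV F 2 θ h v))
    (hLite : ∀ (F : T4Family) (θ : Node00.Stage13HParams F 2) (hP : θ.Provisos₁₃SepCoPH F 2) (v : Node00.Revision₁₃ F 2 θ hP),
      (θ.ZhUnity F 2 ∧ θ.SlotsNondegenerate₁₃ F 2) → θ.Admissible F 2 →
      B16.EndStatementBPrinted (Node00.datumOfRecord₁₃SepCoPHV F 2 θ hP v).C → Window (Node00.datumOfRecord₁₃SepCoPHV F 2 θ hP v) →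
      ∃ (Λ : ℕ → ℕ → ℝ) (M : ℝ), HistLipschitz Λ θ.γ (Node00.datumOfRecord₁₃SepCoPHV F 2 θ hP v).βfun ∧ ∀ k, ∑ i : Fin (k + 1), |Λ k i| ≤ M)
    (hCD : ∀ (F : T4Family) (θ : Node00.Stage13HParams F 2) (hP : θ.Provisos₁₃SepCoPH F 2) (v : Node00.Revision₁₃ F 2 θ hP),
      (θ.ZhUnity F 2 ∧ θ.SlotsNondegenerate₁₃ F 2) → θ.Admissible F 2 →
      B16.EndStatementBPrinted (Node00.datumOfRecord₁₃SepCoPHV F 2 θ hP v).C → Window (Node00.datumOfRecord₁₃SepCoPHV F 2 θ hP v) →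
      ∃ (b : ℕ → ℝ) (s A : ℝ), ScaleAnchor (Node00.datumOfRecord₁₃SepCoPHV F 2 θ hP v).βfun b ∧ 0 < s ∧ OneLoopDrift s A b) :
    StabilityBRunRowsAtRecordR13SepCoPHV :=
  stabilityBRunRowsAtRecordR13SepCoPHV_of_k17V_rowsContAllV h1V (rowsContAllV_of_u3LiteKV_cornerDriftPosKV hLite hCD)

/-- **… and with K3⁷'s FULL U3 TRIPLE at the slot** (U3ᴷⱽ ⟹ U3ᴷ-liteⱽ by `u3LiteKV_of_u3KV`, then ★ above): the slot-keyed K1⁷-shape + U3ᴷⱽ + 2ᶜᴰⱽ ⟹ K1⁹ BY NAME.  CONDITIONAL on three displayed texts;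
K1⁹ NOT closed; nothing of Bałaban asserted. [cite: Balaban1989LargeFieldII, Thm 1 p.355; Balaban1987RG1, Thm 3 p.264, (2.12)-(2.14) p.268, (5.10) p.293, §1 pp.263-264 and §5 p.298] -/
theorem stabilityBRunRowsAtRecordR13SepCoPHV_of_k17V_u3KV_cornerDriftPosKV
    (h1V : ∀ F : T4Family, Inhabited13 F →
      ∃ (θ : Node00.Stage13HParams F 2) (h : θ.Provisos₁₃SepCoPH F 2) (v : Node00.Revision₁₃ F 2 θ h), (θ.ZhUnity F 2 ∧ θ.SlotsNondegenerate₁₃ F 2) ∧ θ.Admissible F 2 ∧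
        B16.EndStatementBPrinted (Node00.datumOfRecord₁₃SepCoPHV F 2 θ h v).C ∧ Window (Node00.datumOfRecord₁₃SepCoPHV F 2 θ h v))
    (hU3 : ∀ (F : T4Family) (θ : Node00.Stage13HParams F 2) (hP : θ.Provisos₁₃SepCoPH F 2) (v : Node00.Revision₁₃ F 2 θ hP),
      (θ.ZhUnity F 2 ∧ θ.SlotsNondegenerate₁₃ F 2) → θ.Admissible F 2 →
      B16.EndStatementBPrinted (Node00.datumOfRecord₁₃SepCoPHV F 2 θ hP v).C → Window (Node00.datumOfRecord₁₃SepCoPHV F 2 θ hP v) →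
      ∃ (c C ρ : ℝ) (Λ : ℕ → ℕ → ℝ), 0 ≤ c ∧ 0 < ρ ∧ ρ < 1 ∧ ScaleShiftRate c ρ θ.γ (Node00.datumOfRecord₁₃SepCoPHV F 2 θ hP v).βfun ∧
        HistLipschitz Λ θ.γ (Node00.datumOfRecord₁₃SepCoPHV F 2 θ hP v).βfun ∧ FadingMemory C ρ Λ)
    (hCD : ∀ (F : T4Family) (θ : Node00.Stage13HParams F 2) (hP : θ.Provisos₁₃SepCoPH F 2) (v : Node00.Revision₁₃ F 2 θ hP),
      (θ.ZhUnity F 2 ∧ θ.SlotsNondegenerate₁₃ F 2) → θ.Admissible F 2 →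
      B16.EndStatementBPrinted (Node00.datumOfRecord₁₃SepCoPHV F 2 θ hP v).C → Window (Node00.datumOfRecord₁₃SepCoPHV F 2 θ hP v) →
      ∃ (b : ℕ → ℝ) (s A : ℝ), ScaleAnchor (Node00.datumOfRecord₁₃SepCoPHV F 2 θ hP v).βfun b ∧ 0 < s ∧ OneLoopDrift s A b) :
    StabilityBRunRowsAtRecordR13SepCoPHV :=
  stabilityBRunRowsAtRecordR13SepCoPHV_of_k17V_u3LiteKV_cornerDriftPosKV h1V (u3LiteKV_of_u3KV hU3) hCD

end SlotTexts

/-! ## §3 Transfer: which K-texts of record serve every slot, and the slot edition is the stronger text -/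

section Transfer

variable (Q : (F : T4Family) → (θ : Node00.Stage13HParams F 2) → θ.Provisos₁₃SepCoPH F 2 → Prop)

/-- **A (B)-FREE SUPPLIER TEXT SERVES EVERY SLOT**: a K-text for the letter `Q` keyed on unity∧slots, admissibility and the record window `Window13 F θ hP` ALONE (no (B) antecedent — the
shape the moduli ∕ anchor ∕ drift desks actually produce) gives the slot-keyed text at every version `v` (the window at the slot datum IS the record's: the flow face is version-free,
`Node00.flow_datumOfRecord₁₃SepCoPHV`, `rfl`).  Bookkeeping. [cite: Balaban1988Convergent, (2.18) p.257 (bookkeeping)] -/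
theorem slotText_of_bFreeText
    (h : ∀ (F : T4Family) (θ : Node00.Stage13HParams F 2) (hP : θ.Provisos₁₃SepCoPH F 2), (θ.ZhUnity F 2 ∧ θ.SlotsNondegenerate₁₃ F 2) → θ.Admissible F 2 →
      Window13 F θ hP → Q F θ hP) :
    ∀ (F : T4Family) (θ : Node00.Stage13HParams F 2) (hP : θ.Provisos₁₃SepCoPH F 2) (v : Node00.Revision₁₃ F 2 θ hP),
      (θ.ZhUnity F 2 ∧ θ.SlotsNondegenerate₁₃ F 2) → θ.Admissible F 2 →
      B16.EndStatementBPrinted (Node00.datumOfRecord₁₃SepCoPHV F 2 θ hP v).C → Window (Node00.datumOfRecord₁₃SepCoPHV F 2 θ hP v) → Q F θ hP :=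
  fun F θ hP _v hU hθ _hB hwin => h F θ hP hU hθ hwin

/-- **A SUPPLIER TEXT READING ONLY [V] THM 1's CLAUSE SERVES EVERY SLOT**: (B) `B16.EndStatementBPrinted = Thm1Printed ∧ Cor3_250` (B16 :419) and [V] Thm 1's clause is version-free
(`Node00.thm1Printed_datumOfRecord₁₃SepCoPHV_iff`, `Iff.rfl` — it reads `flow` and `Sect2Form` only); so a K-text whose antecedent is `B16.Thm1Printed (datumOfRecord₁₃SepCoPH F 2 θ hP).C`
(not the Cor-3 half) gives the slot-keyed text at every `v`.  Bookkeeping. [cite: Balaban1989LargeFieldII, Thm 1 p.355; Balaban1988Convergent, Cor. 3 (2.50) p.264 (bookkeeping)] -/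
theorem slotText_of_thm1Text
    (h : ∀ (F : T4Family) (θ : Node00.Stage13HParams F 2) (hP : θ.Provisos₁₃SepCoPH F 2), (θ.ZhUnity F 2 ∧ θ.SlotsNondegenerate₁₃ F 2) → θ.Admissible F 2 →
      B16.Thm1Printed (Node00.datumOfRecord₁₃SepCoPH F 2 θ hP).C → Window13 F θ hP → Q F θ hP) :
    ∀ (F : T4Family) (θ : Node00.Stage13HParams F 2) (hP : θ.Provisos₁₃SepCoPH F 2) (v : Node00.Revision₁₃ F 2 θ hP),
      (θ.ZhUnity F 2 ∧ θ.SlotsNondegenerate₁₃ F 2) → θ.Admissible F 2 →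
      B16.EndStatementBPrinted (Node00.datumOfRecord₁₃SepCoPHV F 2 θ hP v).C → Window (Node00.datumOfRecord₁₃SepCoPHV F 2 θ hP v) → Q F θ hP :=
  fun F θ hP v hU hθ hB hwin => h F θ hP hU hθ ((Node00.thm1Printed_datumOfRecord₁₃SepCoPHV_iff F 2 θ hP v).mp hB.1) hwin

/-- **THE SLOT EDITION IS THE STRONGER TEXT** (`v := Node00.Revision₁₃.refl`, door `Node00.datumOfRecord₁₃SepCoPHV_refl` `rfl`): a slot-keyed K-text for `Q` gives the record-keyed K-text of
p613914 ∕ p620216 ∕ p622247 — so every concluder of record keyed on the old texts is fed by the new ones; the converse is NOT available ((B)ⱽ at a non-trivial slot does not give (B) at the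
record: Cor-3 is pointwise in the re-chosen densities).  Bookkeeping. [cite: Balaban1988Convergent, Cor. 3 (2.50) p.264 (bookkeeping)] -/
theorem recordText_of_slotText
    (h : ∀ (F : T4Family) (θ : Node00.Stage13HParams F 2) (hP : θ.Provisos₁₃SepCoPH F 2) (v : Node00.Revision₁₃ F 2 θ hP),
      (θ.ZhUnity F 2 ∧ θ.SlotsNondegenerate₁₃ F 2) → θ.Admissible F 2 →
      B16.EndStatementBPrinted (Node00.datumOfRecord₁₃SepCoPHV F 2 θ hP v).C → Window (Node00.datumOfRecord₁₃SepCoPHV F 2 θ hP v) → Q F θ hP) :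
    ∀ (F : T4Family) (θ : Node00.Stage13HParams F 2) (hP : θ.Provisos₁₃SepCoPH F 2), (θ.ZhUnity F 2 ∧ θ.SlotsNondegenerate₁₃ F 2) → θ.Admissible F 2 →
      B16.EndStatementBPrinted (Node00.datumOfRecord₁₃SepCoPH F 2 θ hP).C → Window13 F θ hP → Q F θ hP :=
  fun F θ hP hU hθ hB hwin => h F θ hP (Node00.Revision₁₃.refl F 2 θ hP) hU hθ hB hwin

end Transfer

section RecordProgramme

/-- **THE SLOT TEXTS STILL PAY THE RECORD PROGRAMME `RowsContAll`** (DEF-1 p616926; hence the aside K2⁷ by `endpointGivenBR13SepCoPH_of_rowsContAll` and, with the aside K1⁷, K1⁸ — every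
concluder of record keyed on the old texts is fed by the new ones): `recordText_of_slotText` twice (`v := refl`), then p622247's ★★ `rowsContAll_of_u3LiteK_cornerDriftPosK`.  CONDITIONAL on
two displayed texts; instance 0∕1; nothing of Bałaban asserted. [cite: Balaban1987RG1, Thm 3 p.264, (2.12)-(2.14) p.268, (5.10) p.293, §1 pp.263-264 and §5 p.298] -/
theorem rowsContAll_of_u3LiteKV_cornerDriftPosKV
    (hLite : ∀ (F : T4Family) (θ : Node00.Stage13HParams F 2) (hP : θ.Provisos₁₃SepCoPH F 2) (v : Node00.Revision₁₃ F 2 θ hP),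
      (θ.ZhUnity F 2 ∧ θ.SlotsNondegenerate₁₃ F 2) → θ.Admissible F 2 →
      B16.EndStatementBPrinted (Node00.datumOfRecord₁₃SepCoPHV F 2 θ hP v).C → Window (Node00.datumOfRecord₁₃SepCoPHV F 2 θ hP v) →
      ∃ (Λ : ℕ → ℕ → ℝ) (M : ℝ), HistLipschitz Λ θ.γ (Node00.datumOfRecord₁₃SepCoPHV F 2 θ hP v).βfun ∧ ∀ k, ∑ i : Fin (k + 1), |Λ k i| ≤ M)
    (hCD : ∀ (F : T4Family) (θ : Node00.Stage13HParams F 2) (hP : θ.Provisos₁₃SepCoPH F 2) (v : Node00.Revision₁₃ F 2 θ hP),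
      (θ.ZhUnity F 2 ∧ θ.SlotsNondegenerate₁₃ F 2) → θ.Admissible F 2 →
      B16.EndStatementBPrinted (Node00.datumOfRecord₁₃SepCoPHV F 2 θ hP v).C → Window (Node00.datumOfRecord₁₃SepCoPHV F 2 θ hP v) →
      ∃ (b : ℕ → ℝ) (s A : ℝ), ScaleAnchor (Node00.datumOfRecord₁₃SepCoPHV F 2 θ hP v).βfun b ∧ 0 < s ∧ OneLoopDrift s A b) : RowsContAll :=
  rowsContAll_of_u3LiteK_cornerDriftPosK
    (recordText_of_slotText
      (fun F θ hP => ∃ (Λ : ℕ → ℕ → ℝ) (M : ℝ), HistLipschitz Λ θ.γ (Node00.datumOfRecord₁₃SepCoPH F 2 θ hP).βfun ∧ ∀ k, ∑ i : Fin (k + 1), |Λ k i| ≤ M) hLite)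
    (recordText_of_slotText
      (fun F θ hP => ∃ (b : ℕ → ℝ) (s A : ℝ), ScaleAnchor (Node00.datumOfRecord₁₃SepCoPH F 2 θ hP).βfun b ∧ 0 < s ∧ OneLoopDrift s A b) hCD)

/-- **THE ASIDE K1⁷ (stmt-QuantumFields-20542: (B) AT THE RECORD) + THE SLOT TEXTS ⟹ K1⁹ BY NAME** — through the record programme, DEF-1's `stabilityBRunRowsAtRecordR13SepCoPH_of_k17_rowsContAll`
(K1⁸) and DEF-1's `refl` door: the slot editions lose nothing against the rev-27 concluders.  CONDITIONAL on three displayed texts (none supplied here); K1⁹ NOT closed; nothing of Bałaban asserted; no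
count moved. [cite: Balaban1989LargeFieldII, Thm 1 p.355; Balaban1987RG1, Thm 3 p.264, (2.12)-(2.14) p.268, (5.10) p.293, §1 pp.263-264 and §5 p.298] -/
theorem stabilityBRunRowsAtRecordR13SepCoPHV_of_k17_u3LiteKV_cornerDriftPosKV (h1 : StabilityBAtRecordR13SepCoPH)
    (hLite : ∀ (F : T4Family) (θ : Node00.Stage13HParams F 2) (hP : θ.Provisos₁₃SepCoPH F 2) (v : Node00.Revision₁₃ F 2 θ hP),
      (θ.ZhUnity F 2 ∧ θ.SlotsNondegenerate₁₃ F 2) → θ.Admissible F 2 →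
      B16.EndStatementBPrinted (Node00.datumOfRecord₁₃SepCoPHV F 2 θ hP v).C → Window (Node00.datumOfRecord₁₃SepCoPHV F 2 θ hP v) →
      ∃ (Λ : ℕ → ℕ → ℝ) (M : ℝ), HistLipschitz Λ θ.γ (Node00.datumOfRecord₁₃SepCoPHV F 2 θ hP v).βfun ∧ ∀ k, ∑ i : Fin (k + 1), |Λ k i| ≤ M)
    (hCD : ∀ (F : T4Family) (θ : Node00.Stage13HParams F 2) (hP : θ.Provisos₁₃SepCoPH F 2) (v : Node00.Revision₁₃ F 2 θ hP),
      (θ.ZhUnity F 2 ∧ θ.SlotsNondegenerate₁₃ F 2) → θ.Admissible F 2 →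
      B16.EndStatementBPrinted (Node00.datumOfRecord₁₃SepCoPHV F 2 θ hP v).C → Window (Node00.datumOfRecord₁₃SepCoPHV F 2 θ hP v) →
      ∃ (b : ℕ → ℝ) (s A : ℝ), ScaleAnchor (Node00.datumOfRecord₁₃SepCoPHV F 2 θ hP v).βfun b ∧ 0 < s ∧ OneLoopDrift s A b) :
    StabilityBRunRowsAtRecordR13SepCoPHV :=
  stabilityBRunRowsAtRecordR13SepCoPHV_of_k1R8 (stabilityBRunRowsAtRecordR13SepCoPH_of_k17_rowsContAll h1 (rowsContAll_of_u3LiteKV_cornerDriftPosKV hLite hCD))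

end RecordProgramme

section BFree

/-- **★ K1⁹ BY NAME FROM A SLOT-KEYED K1⁷-SHAPE AND THE TWO CORNER LETTERS KEYED ON ADMISSIBILITY + THE RECORD WINDOW ALONE** (the suppliers' honest currency: the U3-lite moduli with bounded
mass and the anchored positive drift are statements about `β_θ`, read no (B) and no slot): `slotText_of_bFreeText` twice, then ★ `…V_of_k17V_rowsContAllV`.  So on the corner road the
ONLY slot-sensitive input of K1⁹ is the (B)ⱽ-supplier's K1⁷-shape witness (N13's a.e. edition + DEF-1's adapter `Node00.exists_revision₁₃_endStatementBPrinted_of_exists_update`); the β-side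
letters transfer verbatim.  CONDITIONAL on three displayed texts (none supplied here); K1⁹ NOT closed; nothing of Bałaban asserted; no count moved.
[cite: Balaban1989LargeFieldII, Thm 1 p.355; Balaban1988Convergent, Cor. 3 (2.50) p.264; Balaban1987RG1, Thm 3 p.264, (2.12)-(2.14) p.268, (5.10) p.293, §1 pp.263-264 and §5 p.298] -/
theorem stabilityBRunRowsAtRecordR13SepCoPHV_of_k17V_bFree_u3Lite_cornerDriftPos
    (h1V : ∀ F : T4Family, Inhabited13 F →
      ∃ (θ : Node00.Stage13HParams F 2) (h : θ.Provisos₁₃SepCoPH F 2) (v : Node00.Revision₁₃ F 2 θ h), (θ.ZhUnity F 2 ∧ θ.SlotsNondegenerate₁₃ F 2) ∧ θ.Admissible F 2 ∧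
        B16.EndStatementBPrinted (Node00.datumOfRecord₁₃SepCoPHV F 2 θ h v).C ∧ Window (Node00.datumOfRecord₁₃SepCoPHV F 2 θ h v))
    (hLite : ∀ (F : T4Family) (θ : Node00.Stage13HParams F 2) (hP : θ.Provisos₁₃SepCoPH F 2), (θ.ZhUnity F 2 ∧ θ.SlotsNondegenerate₁₃ F 2) → θ.Admissible F 2 → Window13 F θ hP →
      ∃ (Λ : ℕ → ℕ → ℝ) (M : ℝ), HistLipschitz Λ θ.γ (Node00.datumOfRecord₁₃SepCoPH F 2 θ hP).βfun ∧ ∀ k, ∑ i : Fin (k + 1), |Λ k i| ≤ M)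
    (hCD : ∀ (F : T4Family) (θ : Node00.Stage13HParams F 2) (hP : θ.Provisos₁₃SepCoPH F 2), (θ.ZhUnity F 2 ∧ θ.SlotsNondegenerate₁₃ F 2) → θ.Admissible F 2 → Window13 F θ hP →
      ∃ (b : ℕ → ℝ) (s A : ℝ), ScaleAnchor (Node00.datumOfRecord₁₃SepCoPH F 2 θ hP).βfun b ∧ 0 < s ∧ OneLoopDrift s A b) :
    StabilityBRunRowsAtRecordR13SepCoPHV :=
  stabilityBRunRowsAtRecordR13SepCoPHV_of_k17V_rowsContAllV h1V
    (rowsContAllV_of_u3LiteKV_cornerDriftPosKV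
      (slotText_of_bFreeText
        (fun F θ hP => ∃ (Λ : ℕ → ℕ → ℝ) (M : ℝ), HistLipschitz Λ θ.γ (Node00.datumOfRecord₁₃SepCoPH F 2 θ hP).βfun ∧ ∀ k, ∑ i : Fin (k + 1), |Λ k i| ≤ M) hLite)
      (slotText_of_bFreeText
        (fun F θ hP => ∃ (b : ℕ → ℝ) (s A : ℝ), ScaleAnchor (Node00.datumOfRecord₁₃SepCoPH F 2 θ hP).βfun b ∧ 0 < s ∧ OneLoopDrift s A b) hCD))

/-- **… AND WITH THE TWO LETTERS KEYED ON [V] THM 1's CLAUSE** (the version-free half of (B): `slotText_of_thm1Text` twice, then ★ `…V_of_k17V_rowsContAllV`): suppliers that read the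
small-field representation (2.17)–(2.18) but NOT Cor-3's pointwise bounds still serve every slot.  CONDITIONAL on three displayed texts; K1⁹ NOT closed; nothing of Bałaban asserted.
[cite: Balaban1989LargeFieldII, Thm 1 p.355; Balaban1988Convergent, (2.18) p.257, Cor. 3 (2.50) p.264; Balaban1987RG1, Thm 3 p.264, (2.12)-(2.14) p.268, (5.10) p.293, §1 pp.263-264] -/
theorem stabilityBRunRowsAtRecordR13SepCoPHV_of_k17V_thm1_u3Lite_cornerDriftPos
    (h1V : ∀ F : T4Family, Inhabited13 F →
      ∃ (θ : Node00.Stage13HParams F 2) (h : θ.Provisos₁₃SepCoPH F 2) (v : Node00.Revision₁₃ F 2 θ h), (θ.ZhUnity F 2 ∧ θ.SlotsNondegenerate₁₃ F 2) ∧ θ.Admissible F 2 ∧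
        B16.EndStatementBPrinted (Node00.datumOfRecord₁₃SepCoPHV F 2 θ h v).C ∧ Window (Node00.datumOfRecord₁₃SepCoPHV F 2 θ h v))
    (hLite : ∀ (F : T4Family) (θ : Node00.Stage13HParams F 2) (hP : θ.Provisos₁₃SepCoPH F 2), (θ.ZhUnity F 2 ∧ θ.SlotsNondegenerate₁₃ F 2) → θ.Admissible F 2 →
      B16.Thm1Printed (Node00.datumOfRecord₁₃SepCoPH F 2 θ hP).C → Window13 F θ hP →
      ∃ (Λ : ℕ → ℕ → ℝ) (M : ℝ), HistLipschitz Λ θ.γ (Node00.datumOfRecord₁₃SepCoPH F 2 θ hP).βfun ∧ ∀ k, ∑ i : Fin (k + 1), |Λ k i| ≤ M)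
    (hCD : ∀ (F : T4Family) (θ : Node00.Stage13HParams F 2) (hP : θ.Provisos₁₃SepCoPH F 2), (θ.ZhUnity F 2 ∧ θ.SlotsNondegenerate₁₃ F 2) → θ.Admissible F 2 →
      B16.Thm1Printed (Node00.datumOfRecord₁₃SepCoPH F 2 θ hP).C → Window13 F θ hP →
      ∃ (b : ℕ → ℝ) (s A : ℝ), ScaleAnchor (Node00.datumOfRecord₁₃SepCoPH F 2 θ hP).βfun b ∧ 0 < s ∧ OneLoopDrift s A b) :
    StabilityBRunRowsAtRecordR13SepCoPHV :=
  stabilityBRunRowsAtRecordR13SepCoPHV_of_k17V_rowsContAllV h1V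
    (rowsContAllV_of_u3LiteKV_cornerDriftPosKV
      (slotText_of_thm1Text
        (fun F θ hP => ∃ (Λ : ℕ → ℕ → ℝ) (M : ℝ), HistLipschitz Λ θ.γ (Node00.datumOfRecord₁₃SepCoPH F 2 θ hP).βfun ∧ ∀ k, ∑ i : Fin (k + 1), |Λ k i| ≤ M) hLite)
      (slotText_of_thm1Text
        (fun F θ hP => ∃ (b : ℕ → ℝ) (s A : ℝ), ScaleAnchor (Node00.datumOfRecord₁₃SepCoPH F 2 θ hP).βfun b ∧ 0 < s ∧ OneLoopDrift s A b) hCD))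

/-- **… AND FROM THE «∃ v, (B)ⱽ» DISPLAY AT A RECORD-WINDOW WITNESS** (the conclusion shape of dag-n13-w1's landed junction `K1R9VersionSlotOfAEAtRecord.exists_revision₁₃_endStatementBPrinted_of_ae`
inside a K1⁷-type witness: «∃ θ h, unity∧slots ∧ Adm ∧ (∃ v, (B)ⱽ) ∧ Window (datumOfRecord₁₃SepCoPH …)» = DEF-1's `…_iff_existsSlot` display minus the rows): re-associate the slot binder (the
window is version-free, `rfl`) and apply ★ above.  CONDITIONAL on three displayed texts; K1⁹ NOT closed; nothing of Bałaban asserted; no count moved.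
[cite: Balaban1989LargeFieldII, Thm 1 p.355; Balaban1988Convergent, Cor. 3 (2.50) p.264; Balaban1987RG1, Thm 3 p.264, (2.12)-(2.14) p.268, (5.10) p.293, §1 pp.263-264 and §5 p.298] -/
theorem stabilityBRunRowsAtRecordR13SepCoPHV_of_k17ExistsSlot_bFree_u3Lite_cornerDriftPos
    (h1E : ∀ F : T4Family, Inhabited13 F →
      ∃ (θ : Node00.Stage13HParams F 2) (h : θ.Provisos₁₃SepCoPH F 2), (θ.ZhUnity F 2 ∧ θ.SlotsNondegenerate₁₃ F 2) ∧ θ.Admissible F 2 ∧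
        (∃ v : Node00.Revision₁₃ F 2 θ h, B16.EndStatementBPrinted (Node00.datumOfRecord₁₃SepCoPHV F 2 θ h v).C) ∧ Window (Node00.datumOfRecord₁₃SepCoPH F 2 θ h))
    (hLite : ∀ (F : T4Family) (θ : Node00.Stage13HParams F 2) (hP : θ.Provisos₁₃SepCoPH F 2), (θ.ZhUnity F 2 ∧ θ.SlotsNondegenerate₁₃ F 2) → θ.Admissible F 2 → Window13 F θ hP →
      ∃ (Λ : ℕ → ℕ → ℝ) (M : ℝ), HistLipschitz Λ θ.γ (Node00.datumOfRecord₁₃SepCoPH F 2 θ hP).βfun ∧ ∀ k, ∑ i : Fin (k + 1), |Λ k i| ≤ M)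
    (hCD : ∀ (F : T4Family) (θ : Node00.Stage13HParams F 2) (hP : θ.Provisos₁₃SepCoPH F 2), (θ.ZhUnity F 2 ∧ θ.SlotsNondegenerate₁₃ F 2) → θ.Admissible F 2 → Window13 F θ hP →
      ∃ (b : ℕ → ℝ) (s A : ℝ), ScaleAnchor (Node00.datumOfRecord₁₃SepCoPH F 2 θ hP).βfun b ∧ 0 < s ∧ OneLoopDrift s A b) :
    StabilityBRunRowsAtRecordR13SepCoPHV :=
  stabilityBRunRowsAtRecordR13SepCoPHV_of_k17V_bFree_u3Lite_cornerDriftPos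
    (fun F hF => by
      obtain ⟨θ, h, hU, hθ, ⟨v, hB⟩, hwin⟩ := h1E F hF
      exact ⟨θ, h, v, hU, hθ, hB, hwin⟩)
    hLite hCD

end BFree

end Summit.QuantumFields.YangMills.Theorems.BalabanUVNodesK2CornerRoadRowsV

end
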